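import Literature.MathematicalPhysics.QuantumFieldTheory.Balaban1983to89.B3AttachAllCounterterms
import Literature.MathematicalPhysics.QuantumFieldTheory.Balaban1983to89.B3AttachCountertermDegree

/-!
# `Balaban1983to89.B3AttachAllCountertermsDegree` — T. Bałaban, *(Higgs)₂,₃ quantum fields in a finite volume. III. Renormalization*,
Commun. Math. Phys. **88** (1983) 411–445 [Balaban1983Higgs3]: the sentence after **(2.3)** p. 423 — *"Thus the degree of G is
the same as the degree of a graph G′ obtained from G by attaching the corresponding graphs to the mass renormalization vertices"* —
PROVED on the model for ALL mass renormalization vertices at once (the simultaneous attachment `B3AttachAllCounterterms`)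

statement-level skeleton of published theorems with citation tags; proofs where landed; nothing here is a claim about the Yang–Mills mass gap

PDF held: `paper:balaban1983-higgs-2-3-quantum-fields-finite-volume` (journal page = PDF page + 410); text `lit read` pp. 6–7, 13
(pp. 416–417, 423).  CITATION HEADER (lean-in-tree rule).  lit-balaban TYPED SKELETON (HOME `run/shared/lean/pub/lit-balaban/`),
Phase 2, seat p18 (gen 5), unit `lit-balaban-p18`: SKELETON row **B3.Eq2.2-2.3** (owner r15; decls of record
`B3Sect2Statements.graphDegree` = (2.3), `graphDegree_eq_22`).  p. 423 [PDF 13], verbatim: *"D(G) = Σ_{v∈G} D_G(v) − d + (a sum of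
degrees of mass renormalization counterterms connected with the vertices of the graph G). (2.3) Thus the degree of G is the same as
the degree of a graph G′ obtained from G by attaching the corresponding graphs to the mass renormalization vertices."*

WHAT IS PROVED (sorry-free, axioms standard; the only `def`s are the example data `attachAll1239`, `dyson2`, `dyson2All`).  For a
graph G of the model over any finite vertex type (`B3IGraph.IGraph`) and attachment data `T : AttachAll G` (a finite set S of
(1.7)-vertices, v ↦ the counterterm graph H_v = G₀ of δm²_{G₀} with its two external undifferentiated φ′-legs), with
G′ = `T.attachAll`:
* the (2.1) bookkeeping of G′: an old vertex w ∉ S keeps its incidence counts and D_{G′}(w) = D_G(w) (`vertexDeg_inl`); a vertex u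
  of H_v keeps its counts except that the attachment legs x_k of H_v lying at u become internal exactly when the leg k of v lies on
  a line of G (`intVector_inr`, `intDiffs_inr` — no differentiation sits on an attachment leg —, `sum_intScalar_inr`), so
  Σ_{u∈H_v} D_{G′}(u) = Σ_{u∈H_v} D_{H_v}(u) + i_v·(2−d)/2 with i_v = the number of legs of v on lines of G, while
  D_G(v) = d + i_v·(2−d)/2 (`vertexDeg_v`; (ii) p. 423: = 2 when both legs are internal);
* **`deg_attachAll`**: D_{(2.2)}(G′) = D(G) + Σ_{v∈S} D(H_v), where D(G) = the model's (2.2)-degree of G (counterterm degree 0 at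
  every vertex);
* **`graphDegree23_eq_deg_attachAll`** = the printed sentence: r15's (2.3) `B3Sect2Statements.graphDegree` of G with the counterterm
  degrees ctDeg(v) = D(H_v) for v ∈ S and 0 elsewhere EQUALS the (2.2)-degree of the attached graph G′;
* non-vacuity: (1.23)⑨ p. 417 again (S = {the (1.7)-vertex of (1.22)⑦}, H = (1.22)④; `deg_attachAll1239` = 6 − 2d = gen-4's
  `deg_attach1239`), and a genuinely simultaneous instance, the n = 2 term C₀(−δm²)C₀(−δm²)C₀ of the Dyson series (1.21) p. 416
  (`dyson2`: two (1.7)-vertices in a chain, D = 2) with the order-2 counterterm graph (1.22)④ attached at BOTH vertices: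
  `deg_dyson2All` D = 2 + 2(2 − d) = 6 − 2d.
Since G′ is again an `IGraph`, counterterm graphs whose own (1.7)-vertices carry δm²_k-counterterms are handled by attaching again —
the *"inductive definition"* of (2.3).  SCOPE as in gen 4 (HOME GAPS.md G-B3-10): attachment legs undifferentiated (true for the
counterterm graphs of δm²₁ (1.23)).
-/

namespace Literature.MathematicalPhysics.QuantumFieldTheory.Balaban1983to89.B3AttachAllCountertermsDegree

open Finset B3Prop1 B3Sect2Statements B3VertexBridge B3Cor23Concrete B3OddVectorLoops B3IGraph B3AttachCounterterm
  B3AttachCountertermDegree B3AttachAllCounterterms B3Sect3LowestOrderGraphs B3Sect1Graphs122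

variable {nbar : ℕ} {ι : Type} [Fintype ι] [DecidableEq ι] {G : IGraph nbar ι} (T : AttachAll G)

/-! ## The incidence counts (2.1) of the attached graph at the old vertices -/

omit [Fintype ι] in
/-- kernel: the lines of G′ are `T.other'`. [cite: Balaban1983Higgs3, (2.3) p.423] -/
theorem attachAll_other : T.attachAll.other = T.other' := rfl

omit [Fintype ι] in
/-- kernel: a φ′-leg of an old vertex lies on a line of G′ iff it lies on a line of G. [cite: Balaban1983Higgs3, (2.1) p.422] -/
theorem intScalar_inl (w : {w : ι // w ∉ T.S}) : T.attachAll.intScalar (Sum.inl w) = G.intScalar w.1 := by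
  show (univ.filter fun j : Fin (G.kind w.1).scalarLegs => (T.other' ⟨Sum.inl w, Sum.inl j⟩).isSome).card = _
  unfold IGraph.intScalar
  exact congrArg card (filter_congr fun j _ => by rw [T.other'_inl, Option.isSome_map]; exact Iff.rfl)

omit [Fintype ι] in
/-- kernel: an A′-leg of an old vertex lies on a line of G′ iff it lies on a line of G. [cite: Balaban1983Higgs3, (2.1) p.422] -/
theorem intVector_inl (w : {w : ι // w ∉ T.S}) : T.attachAll.intVector (Sum.inl w) = G.intVector w.1 := by
  show (univ.filter fun j : Fin (G.kind w.1).vectorLegs => (T.other' ⟨Sum.inl w, Sum.inr j⟩).isSome).card = _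
  unfold IGraph.intVector
  exact congrArg card (filter_congr fun j _ => by rw [T.other'_inl, Option.isSome_map]; exact Iff.rfl)

omit [Fintype ι] in
/-- kernel: the differentiations of an old vertex act on lines of G′ iff they act on lines of G. [cite: Balaban1983Higgs3, (2.1) p.422] -/
theorem intDiffs_inl (w : {w : ι // w ∉ T.S}) : T.attachAll.intDiffs (Sum.inl w) = G.intDiffs w.1 := by
  show (if h : 0 < (G.kind w.1).scalarLegs then
      (if (T.other' ⟨Sum.inl w, Sum.inl ⟨0, h⟩⟩).isSome then (G.kind w.1).diffCount else 0) else 0) = _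
  unfold IGraph.intDiffs
  by_cases h : 0 < (G.kind w.1).scalarLegs
  · rw [dif_pos h, dif_pos h, T.other'_inl, Option.isSome_map]
    rfl
  · rw [dif_neg h, dif_neg h]

omit [Fintype ι] in
/-- kernel: D_{G′}(w) = D_G(w) for an old vertex w ∉ S. [cite: Balaban1983Higgs3, (2.1) p.422] -/
theorem vertexDeg_inl (d : ℕ) (w : {w : ι // w ∉ T.S}) : T.attachAll.vertexDeg d (Sum.inl w) = G.vertexDeg d w.1 := by
  rw [IGraph.vertexDeg_eq, IGraph.vertexDeg_eq, intScalar_inl, intVector_inl, intDiffs_inl]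
  rfl

/-! ## The incidence counts (2.1) of the attached graph at the vertices of the counterterm graphs -/

omit [Fintype ι] in
/-- kernel: an attachment leg lies on a line of G′ iff the corresponding leg of v lies on a line of G.
[cite: Balaban1983Higgs3, (2.3) p.423] -/
theorem isSome_other'_X (a : T.S) (k : Fin 2) : (T.other' (T.X a k)).isSome = (G.other (T.leg a k)).isSome := by
  rw [T.other'_X, Option.isSome_map]

omit [Fintype ι] in
/-- kernel: a φ′-leg of H_v other than the attachment legs lies on a line of G′ iff it lies on a line of H_v.
[cite: Balaban1983Higgs3, (2.3) p.423] -/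
theorem isSome_other'_of_ne (a : T.S) (u : Fin (T.H a).nV) (j : Fin ((T.H a).kind u).scalarLegs)
    (h : ∀ k, (T.ct a).x k ≠ ⟨u, j⟩) :
    (T.other' ⟨Sum.inr ⟨a, u⟩, Sum.inl j⟩).isSome = ((T.H a).other ⟨u, .inl j⟩).isSome := by
  have : T.other' ⟨Sum.inr ⟨a, u⟩, Sum.inl j⟩ = ((T.H a).other ⟨u, .inl j⟩).map (T.embH a) :=
    T.other'_embH a (l := ⟨u, .inl j⟩) ((T.ct a).ne_xleg_inl u j h)
  rw [this, Option.isSome_map]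

omit [Fintype ι] in
/-- kernel: an A′-leg of a vertex of H_v lies on a line of G′ iff it lies on a line of H_v. [cite: Balaban1983Higgs3, (2.1) p.422] -/
theorem intVector_inr (a : T.S) (u : Fin (T.H a).nV) : T.attachAll.intVector (Sum.inr ⟨a, u⟩) = (T.H a).intVector u := by
  show (univ.filter fun j : Fin ((T.H a).kind u).vectorLegs => (T.other' ⟨Sum.inr ⟨a, u⟩, Sum.inr j⟩).isSome).card = _
  unfold Graph.intVector
  refine congrArg card (filter_congr fun j _ => ?_)
  have : T.other' ⟨Sum.inr ⟨a, u⟩, Sum.inr j⟩ = ((T.H a).other ⟨u, .inr j⟩).map (T.embH a) :=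
    T.other'_embH a (l := ⟨u, .inr j⟩) ((T.ct a).ne_xleg_inr u j)
  rw [this, Option.isSome_map]

omit [Fintype ι] in
/-- kernel: the differentiations of a vertex of H_v act on lines of G′ iff they act on lines of H_v (the attachment legs carry no
differentiation). [cite: Balaban1983Higgs3, (2.1) p.422] -/
theorem intDiffs_inr (a : T.S) (u : Fin (T.H a).nV) : T.attachAll.intDiffs (Sum.inr ⟨a, u⟩) = (T.H a).intDiffs u := by
  show (if h : 0 < ((T.H a).kind u).scalarLegs then
      (if (T.other' ⟨Sum.inr ⟨a, u⟩, Sum.inl (⟨0, h⟩ : Fin ((T.H a).kind u).scalarLegs)⟩).isSome then ((T.H a).kind u).diffCount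
        else 0) else 0) = _
  unfold Graph.intDiffs
  by_cases h : 0 < ((T.H a).kind u).scalarLegs
  · rw [dif_pos h, dif_pos h]
    by_cases hx : ∃ k, (T.ct a).x k = ⟨u, ⟨0, h⟩⟩
    · obtain ⟨k, hk⟩ := hx
      have h1 : ((T.ct a).x k).1 = u := by rw [hk]
      have h2 : (((T.ct a).x k).2 : ℕ) = 0 := by rw [hk]
      have h0 : ((T.H a).kind u).diffCount = 0 := by
        have := (T.ct a).undiff k h2
        rwa [h1] at this
      simp [h0]
    · rw [isSome_other'_of_ne T a u ⟨0, h⟩ fun k hk => hx ⟨k, hk⟩]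
  · rw [dif_neg h, dif_neg h]

omit [Fintype ι] in
/-- kernel: D_{G′}(u) for a vertex u of H_v differs from D_{H_v}(u) only through the newly internal φ′-legs.
[cite: Balaban1983Higgs3, (2.1) p.422] -/
theorem vertexDeg_inr (d : ℕ) (a : T.S) (u : Fin (T.H a).nV) :
    T.attachAll.vertexDeg d (Sum.inr ⟨a, u⟩) =
      (T.H a).vertexDeg d u + ((T.attachAll.intScalar (Sum.inr ⟨a, u⟩) : ℚ) - (T.H a).intScalar u) * ((2 - (d : ℚ)) / 2) := by
  rw [IGraph.vertexDeg_eq, Graph.vertexDeg_eq, intVector_inr, intDiffs_inr]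
  have hk : T.attachAll.kind (Sum.inr ⟨a, u⟩) = (T.H a).kind u := rfl
  rw [hk]
  push_cast
  ring

omit [Fintype ι] in
/-- kernel: the φ′-legs of H_v lying on lines of G′ are those lying on lines of H_v together with the attachment legs x k whose
leg k of v lies on a line of G. [cite: Balaban1983Higgs3, (2.3) p.423] -/
theorem sum_intScalar_inr (a : T.S) :
    ∑ u, T.attachAll.intScalar (Sum.inr ⟨a, u⟩) =
      ∑ u, (T.H a).intScalar u + (univ.filter fun k : Fin 2 => (G.other (T.leg a k)).isSome).card := by
  classical
  have hL : ∑ u, T.attachAll.intScalar (Sum.inr ⟨a, u⟩) =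
      (univ.filter fun y : SLeg (T.H a) => (T.other' ⟨Sum.inr ⟨a, y.1⟩, Sum.inl y.2⟩).isSome).card := by
    rw [card_filter, Fintype.sum_sigma]
    refine sum_congr rfl fun u _ => ?_
    show (univ.filter fun j : Fin ((T.H a).kind u).scalarLegs => (T.other' ⟨Sum.inr ⟨a, u⟩, Sum.inl j⟩).isSome).card = _
    rw [card_filter]
  have hR : ∑ u, (T.H a).intScalar u =
      (univ.filter fun y : SLeg (T.H a) => ((T.H a).other ⟨y.1, .inl y.2⟩).isSome).card := by
    rw [card_filter, Fintype.sum_sigma]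
    refine sum_congr rfl fun u _ => ?_
    unfold Graph.intScalar
    rw [card_filter]
  rw [hL, hR, ← card_filter_add_card_filter_not (s := univ.filter fun y : SLeg (T.H a) =>
      (T.other' ⟨Sum.inr ⟨a, y.1⟩, Sum.inl y.2⟩).isSome) (fun y : SLeg (T.H a) => ∃ k, (T.ct a).x k = y), add_comm]
  congr 1
  · -- the φ′-legs of H_v other than the attachment legs
    congr 1
    ext ⟨u, j⟩
    simp only [mem_filter, mem_univ, true_and, not_exists]
    constructor
    · rintro ⟨h1, h2⟩
      rwa [isSome_other'_of_ne T a u j h2] at h1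
    · intro h1
      have h2 : ∀ k, (T.ct a).x k ≠ ⟨u, j⟩ := by
        intro k hk
        have hext := (T.ct a).ext k
        rw [hk] at hext
        rw [hext] at h1
        simp at h1
      exact ⟨by rwa [isSome_other'_of_ne T a u j h2], h2⟩
  · -- the attachment legs
    rw [← card_image_of_injective (univ.filter fun k : Fin 2 => (G.other (T.leg a k)).isSome) (T.ct a).x_inj]
    congr 1
    ext y
    simp only [mem_filter, mem_univ, true_and, mem_image]
    constructor
    · rintro ⟨h1, k, rfl⟩
      exact ⟨k, by rwa [show (⟨Sum.inr ⟨a, ((T.ct a).x k).1⟩, Sum.inl ((T.ct a).x k).2⟩ : ILeg T.kind') = T.X a k from rfl,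
        isSome_other'_X T] at h1, rfl⟩
    · rintro ⟨k, hk, rfl⟩
      refine ⟨?_, k, rfl⟩
      rw [show (⟨Sum.inr ⟨a, ((T.ct a).x k).1⟩, Sum.inl ((T.ct a).x k).2⟩ : ILeg T.kind') = T.X a k from rfl, isSome_other'_X T]
      exact hk

/-! ## The mass renormalization vertices -/

omit [Fintype ι] [DecidableEq ι] in
/-- kernel: the internal φ′-legs of v ∈ S, counted over its two legs. [cite: Balaban1983Higgs3, (1.7) p.413] -/
theorem intScalar_v (a : T.S) : G.intScalar a.1 = (univ.filter fun k : Fin 2 => (G.other (T.leg a k)).isSome).card := by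
  unfold IGraph.intScalar
  rw [card_filter, card_filter]
  exact (Fintype.sum_equiv (finCongr (T.two_eq a)) _ _ fun k => rfl).symm

omit [Fintype ι] [DecidableEq ι] in
/-- kernel, (ii) p. 423 for a vertex (1.7) inside G: D_G(v) = d + i_v (2 − d)/2, i_v the number of its legs on lines of G
(D(v₂) = 2 when both are). [cite: Balaban1983Higgs3, (2.1) p.422] -/
theorem vertexDeg_v (d : ℕ) (a : T.S) :
    G.vertexDeg d a.1 =
      (d : ℚ) + ((univ.filter fun k : Fin 2 => (G.other (T.leg a k)).isSome).card : ℚ) * ((2 - (d : ℚ)) / 2) := by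
  rw [IGraph.vertexDeg_eq, ← intScalar_v]
  have h1 : (G.kind a.1).etaCount d = d := by rw [T.hv a]; rfl
  have h2 : (G.kind a.1).isAveragingVertex = false := by rw [T.hv a]; rfl
  have h3 : G.intVector a.1 = 0 := by have := G.intVector_le a.1; rw [T.vec_eq a] at this; omega
  have h4 : G.intDiffs a.1 = 0 := by
    have h5 : (G.kind a.1).diffCount = 0 := by rw [T.hv a]; rfl
    have := G.intDiffs_le a.1; rw [h5] at this; omega
  rw [h1, h3, h4]
  simp [h2]

/-- kernel: a sum over the vertices of G splits into the vertices outside S and those in S. [cite: Balaban1983Higgs3, (2.2) p.423] -/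
theorem sum_split (f : ι → ℚ) : ∑ i, f i = (∑ w : {w : ι // w ∉ T.S}, f w.1) + ∑ a : T.S, f a.1 := by
  rw [← Finset.sum_add_sum_compl T.S f, add_comm, Finset.sum_coe_sort T.S f,
    Finset.sum_subtype T.Sᶜ (p := fun w => w ∉ T.S) (fun w => Finset.mem_compl) f]

/-! ## The sentence after (2.3) -/

/-- **p. 423** [PDF 13], the sentence after (2.3) — *"Thus the degree of G is the same as the degree of a graph G′ obtained from G
by attaching the corresponding graphs to the mass renormalization vertices"* — ALL of them at once, on the model: the (2.2)-degree of
the attached graph G′ = `T.attachAll` is D(G) [the model's (2.2)-degree, counterterm degree 0 at every vertex] + Σ_{v∈S} D(H_v),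
H_v = the graph G₀ of the counterterm at v. [cite: Balaban1983Higgs3, (2.3) p.423] -/
theorem deg_attachAll (d : ℕ) : T.attachAll.deg d = G.deg d + ∑ a : T.S, (T.H a).deg d := by
  have hS : ∑ w : {w : ι // w ∉ T.S}, T.attachAll.vertexDeg d (Sum.inl w) =
      ∑ w : {w : ι // w ∉ T.S}, G.vertexDeg d w.1 := sum_congr rfl fun w _ => vertexDeg_inl T d w
  have hH : ∀ a : T.S, ∑ u, T.attachAll.vertexDeg d (Sum.inr ⟨a, u⟩) =
      ∑ u, (T.H a).vertexDeg d u +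
        ((univ.filter fun k : Fin 2 => (G.other (T.leg a k)).isSome).card : ℚ) * ((2 - (d : ℚ)) / 2) := by
    intro a
    rw [sum_congr rfl fun u _ => vertexDeg_inr T d a u, sum_add_distrib, ← sum_mul, sum_sub_distrib]
    have := congrArg (fun n : ℕ => (n : ℚ)) (sum_intScalar_inr T a)
    push_cast at this
    rw [this]
    ring
  have hHd : ∀ a : T.S, (T.H a).deg d = (∑ u, (T.H a).vertexDeg d u) - d := fun a => (T.H a).deg_eq d
  unfold IGraph.deg
  rw [Fintype.sum_sum_type, Fintype.sum_sigma, hS, sum_congr rfl fun a _ => hH a, sum_split T (G.vertexDeg d),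
    sum_congr rfl fun a _ => vertexDeg_v T d a, sum_congr rfl fun a _ => hHd a]
  simp only [sum_add_distrib, sum_sub_distrib]
  ring

/-- kernel, (2.3) on the model: r15's `B3Sect2Statements.graphDegree` of a graph G of the model with counterterm degrees `c`
supported on a set S of vertices (0 elsewhere) is the (2.2)-degree of G plus Σ_{v∈S} c(v). [cite: Balaban1983Higgs3, (2.3) p.423] -/
theorem graphDegree_ctDeg (d : ℕ) (S : Finset ι) (c : S → ℚ) :
    graphDegree d univ
        (fun i => (⟨toCounts d (G.kind i),
          ⟨G.intScalar i, G.intVector i, G.intDiffs i, G.intScalar_le i, G.intVector_le i, G.intDiffs_le i⟩,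
          if h : i ∈ S then c ⟨i, h⟩ else 0⟩ : GraphVertex)) =
      G.deg d + ∑ a : S, c a := by
  have hct : (∑ i, if h : i ∈ S then c ⟨i, h⟩ else 0) = ∑ a : S, c a := by
    rw [← Finset.sum_add_sum_compl S, Finset.sum_eq_zero (s := Sᶜ) (fun i hi => by rw [dif_neg (Finset.mem_compl.mp hi)]),
      add_zero, ← Finset.sum_coe_sort]
    exact sum_congr rfl fun a _ => by rw [dif_pos a.2]
  rw [graphDegree, hct]
  rfl

/-- **(2.3) ⇔ (2.2) of G′**, p. 423: r15's (2.3) `B3Sect2Statements.graphDegree` of G — D(G) = Σ_v D_G(v) − d + (the degrees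
D(H_v) = D(G₀) of the mass renormalization counterterms at the vertices v ∈ S, 0 at the other vertices) — EQUALS the (2.2)-degree
of the graph G′ obtained by attaching all the H_v. [cite: Balaban1983Higgs3, (2.3) p.423] -/
theorem graphDegree23_eq_deg_attachAll (d : ℕ) :
    graphDegree d univ
        (fun i => (⟨toCounts d (G.kind i),
          ⟨G.intScalar i, G.intVector i, G.intDiffs i, G.intScalar_le i, G.intVector_le i, G.intDiffs_le i⟩,
          if h : i ∈ T.S then (T.H ⟨i, h⟩).deg d else 0⟩ : GraphVertex)) =
      T.attachAll.deg d := by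
  rw [deg_attachAll]
  exact graphDegree_ctDeg (G := G) d T.S fun a => (T.H a).deg d

/-- The same identity for a graph of `B3Cor23Concrete` (vertex type `Fin nV`, incidence data `Graph.incidence` as in r15's
`B3Cor23Concrete.Graph.vertexData` and gen-4's `graphDegree23_eq_deg_attach`), attached through `toIGraph`.
[cite: Balaban1983Higgs3, (2.3) p.423] -/
theorem graphDegree23_eq_deg_attachAll_graph (d : ℕ) (Gc : Graph nbar) (T : AttachAll (toIGraph Gc)) :
    graphDegree d univ
        (fun i => (⟨toCounts d (Gc.kind i), Gc.incidence d i, if h : i ∈ T.S then (T.H ⟨i, h⟩).deg d else 0⟩ : GraphVertex)) =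
      T.attachAll.deg d :=
  graphDegree23_eq_deg_attachAll T d

/-! ## The printed example (1.23)⑨ as a simultaneous attachment (S a singleton) -/

/-- (1.23)⑨ p. 417 as data for the simultaneous attachment: S = {the (1.7)-vertex x″ of (1.22)⑦} (`g122g`), its counterterm graph
(1.22)④ (`g36a`) with the attachment legs of gen-4's `attach1239`. [cite: Balaban1983Higgs3, (1.23) p.417] -/
def attachAll1239 (hn : 1 ≤ nbar) : AttachAll (toIGraph (g122g nbar hn)) where
  S := {(attach1239 hn).v}
  hv a := by
    have ha : a.1 = (attach1239 hn).v := Finset.mem_singleton.mp a.2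
    rw [ha]; exact (attach1239 hn).hv
  ct _ := ⟨g36a nbar hn, (attach1239 hn).x, (attach1239 hn).x_inj, (attach1239 hn).ext, (attach1239 hn).undiff⟩

/-- (1.23)⑨: degree (4 − d) + (2 − d) = 6 − 2d, as for the one-vertex attachment (`deg_attach1239`) and the typed picture `g123i`.
[cite: Balaban1983Higgs3, (1.23) p.417] -/
theorem deg_attachAll1239 (d : ℕ) (hn : 1 ≤ nbar) : (attachAll1239 hn).attachAll.deg d = 6 - 2 * (d : ℚ) := by
  rw [deg_attachAll, deg_toIGraph, g122g_deg]
  rw [show (∑ a : (attachAll1239 hn).S, ((attachAll1239 hn).H a).deg d) = ∑ _a : (attachAll1239 hn).S, (g36a nbar hn).deg d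
    from rfl, Finset.sum_const, Finset.card_univ, Fintype.card_coe]
  have hc : (attachAll1239 hn).S.card = 1 := Finset.card_singleton _
  rw [hc, one_nsmul, g36a_deg]
  ring

/-- kernel: agreement with gen-4's one-vertex attachment and with the typed picture. [cite: Balaban1983Higgs3, (1.23) p.417] -/
theorem deg_attachAll1239_eq (d : ℕ) (hn : 1 ≤ nbar) :
    (attachAll1239 hn).attachAll.deg d = (attach1239 hn).attach.deg d ∧
      (attachAll1239 hn).attachAll.deg d = (g123i nbar hn).deg d := by
  rw [deg_attachAll1239, deg_attach1239, g123i_deg]; exact ⟨rfl, rfl⟩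

/-! ## A simultaneous instance: the n = 2 term of (1.21) with both counterterm graphs attached -/

/-- The n = 2 term C_{ε0}(−δm²)C_{ε0}(−δm²)C_{ε0} of the Dyson series **(1.21)** p. 416: two mass renormalization vertices (1.7) in a
chain (the leg 1 of the first joined to the leg 0 of the second; the leg 0 of the first and the leg 1 of the second external).
[cite: Balaban1983Higgs3, (1.21) p.416] -/
def dyson2 (nbar : ℕ) : Graph nbar where
  nV := 2
  kind _ := .v17
  adm _ := trivial
  other x := match x with
    | ⟨i, .inl j⟩ =>
      if i.val = 0 then (if j.val = 1 then some ⟨1, .inl ⟨0, by simp [VertexKind.scalarLegs]⟩⟩ else none)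
      else (if j.val = 0 then some ⟨0, .inl ⟨1, by simp [VertexKind.scalarLegs]⟩⟩ else none)
    | ⟨_, .inr j⟩ => j.elim0
  other_ne := by decide
  other_symm := by decide
  other_isLeft := by decide
  exists_line := by decide

/-- kernel: the chain has degree 2d + (2 − d) − d = 2 (each vertex (1.7) with one leg on a line: D_G(v) = d + (2−d)/2).
[cite: Balaban1983Higgs3, (2.2) p.423] -/
theorem dyson2_deg (d : ℕ) : (dyson2 nbar).deg d = 2 := by
  have a0 : (dyson2 nbar).intScalar (0 : Fin 2) = 1 := by rfl
  have a1 : (dyson2 nbar).intScalar (1 : Fin 2) = 1 := by rfl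
  have b0 : (dyson2 nbar).intVector (0 : Fin 2) = 0 := by rfl
  have b1 : (dyson2 nbar).intVector (1 : Fin 2) = 0 := by rfl
  have c0 : (dyson2 nbar).intDiffs (0 : Fin 2) = 0 := by rfl
  have c1 : (dyson2 nbar).intDiffs (1 : Fin 2) = 0 := by rfl
  rw [Graph.deg_eq]
  change (∑ i : Fin 2, (dyson2 nbar).vertexDeg d i) - (d : ℚ) = _
  rw [Fin.sum_univ_two, Graph.vertexDeg_eq, Graph.vertexDeg_eq, a0, a1, b0, b1, c0, c1]
  simp [dyson2, VertexKind.etaCount, VertexKind.isAveragingVertex]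
  ring

/-- Both δm² insertions of the n = 2 term of (1.21) replaced by the counterterm graph of (1.22)④ (`g36a`, the order-e² part of
δm²₁): attachment at BOTH mass renormalization vertices at once. [cite: Balaban1983Higgs3, (1.23) p.417] -/
def dyson2All (hn : 1 ≤ nbar) : AttachAll (toIGraph (dyson2 nbar)) where
  S := univ
  hv _ := rfl
  ct _ := ⟨g36a nbar hn, (attach1239 hn).x, (attach1239 hn).x_inj, (attach1239 hn).ext, (attach1239 hn).undiff⟩

/-- kernel: the doubly attached chain has degree 2 + 2·(2 − d) = 6 − 2d (= 0 in d = 3). [cite: Balaban1983Higgs3, (2.3) p.423] -/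
theorem deg_dyson2All (d : ℕ) (hn : 1 ≤ nbar) : (dyson2All hn).attachAll.deg d = 6 - 2 * (d : ℚ) := by
  rw [deg_attachAll, deg_toIGraph, dyson2_deg]
  rw [show (∑ a : (dyson2All hn).S, ((dyson2All hn).H a).deg d) = ∑ _a : (dyson2All hn).S, (g36a nbar hn).deg d
    from rfl, Finset.sum_const, Finset.card_univ, Fintype.card_coe]
  have hc : (dyson2All hn).S.card = 2 := by rfl
  rw [hc, g36a_deg]
  simp only [nsmul_eq_mul, Nat.cast_ofNat]
  ring

end Literature.MathematicalPhysics.QuantumFieldTheory.Balaban1983to89.B3AttachAllCountertermsDegree
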